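import Mathlib
import HarnessLib
import Summits.AtomisticToContinuum.Crystallization.Theorems.PricedLinkCensusSoftFourRingsRigData

/-!
# Soft four-rings, metric half by certified numerics (13): the HCP certificate stream passes the check, I

Route `PricedLinkCensus`, sub-problem `Crystallization`, item `SoftFourRings`
(stmt-AtomisticToContinuum-14234).  The first 83 HCP cells are certified (`runCell`), evaluated by `native_decide` (about 90 s); the rest and the chart coverage are in `…RigCheckHcp2`, combined in `…RigMain`.
-/

namespace Summit.AtomisticToContinuum.Crystallization.Theorems

namespace Rig

/-- **HCP cells `0 … 82` are certified.** -/
theorem hcp_all_take : (hcpCells.take 83).all (runCell hcpModel) = true := by native_decide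

end Rig

end Summit.AtomisticToContinuum.Crystallization.Theorems
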